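import Summits.Ventures.PercRepro.S2SpanCircuits
import Summits.Ventures.PercRepro.S2TopHitSeven

/-!
# PercRepro — S2: THE TOP `5`-SETS AGAINST FOUR TRIANGLES AT CORANK `7` — THE PRIVATE-PART COUNT (p7, gen 16; sub-claim S2)

At corank `7` a top `5`-set meets the union of any three distinct triangles (`S2.top_five_inter_union_three_nonempty`). With four
triangles `T₁ … T₄`, `W = ⋃ T_i` and the private parts `P_i = T_i ∖ (the others)`, a `5`-set whose trace on `W` lies in some `P_i`
meets at most one triangle — so no top `5`-set has that property (**`top_five_trace_not_subset_private`**) — and the four families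
`A_i = {X : X ∩ W ⊆ P_i}` pairwise meet inside `A₀ = {X ∩ W = ∅}`: **`ncard_union_four_trace_add_le`**:
`Σ_i |A_i| ≤ |⋃ A_i| + 3·|A₀|`, with `|A_i| = C(|(E ∖ W) ∪ P_i|, 5)`. The supersets of a triangle outside `⋃ A_i` are at least
`C(17, 2) − C(|E ∖ W|, 2)` each (**`ncard_supersets_outside_trace_ge`**), and a shared point lies on two triangles:
`2·|W ∖ ⋃ P_i| ≤ Σ_i |T_i ∖ P_i|` (**`two_mul_ncard_shared_le`**). Nothing about any cell is claimed. Axioms: standard.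
-/

open scoped Matroid

namespace PercRepro

namespace S2

open Set

variable {α : Type}

/-- A `5`-subset of `E` whose trace on `W` lies in `P ⊆ W` is a `5`-subset of `(E ∖ W) ∪ P`, and conversely. -/
theorem trace_subset_iff {E W P X : Set α} (hW : W ⊆ E) (hP : P ⊆ W) :
    (X ⊆ E ∧ X ∩ W ⊆ P) ↔ X ⊆ (E \ W) ∪ P := by
  constructor
  · rintro ⟨hXE, hXP⟩ x hx
    by_cases hxW : x ∈ W
    · exact Or.inr (hXP ⟨hx, hxW⟩)
    · exact Or.inl ⟨hXE hx, hxW⟩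
  · intro h
    refine ⟨fun x hx => ?_, fun x hx => ?_⟩
    · rcases h hx with hx' | hx'
      · exact hx'.1
      · exact hW (hP hx')
    · rcases h hx.1 with hx' | hx'
      · exact absurd hx.2 hx'.2
      · exact hx'

/-- **The four trace families**: `Σ_i |A_i| ≤ |A₁ ∪ A₂ ∪ A₃ ∪ A₄| + 3·|A₀|` when the `P_i` are pairwise disjoint. -/
theorem ncard_union_four_trace_add_le (E W P₁ P₂ P₃ P₄ : Set α) (hE : E.Finite)
    (h12 : Disjoint P₁ P₂) (h13 : Disjoint P₁ P₃) (h14 : Disjoint P₁ P₄) (h23 : Disjoint P₂ P₃) (h24 : Disjoint P₂ P₄)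
    (h34 : Disjoint P₃ P₄) :
    {X : Set α | X ⊆ E ∧ X.ncard = 5 ∧ X ∩ W ⊆ P₁}.ncard + {X : Set α | X ⊆ E ∧ X.ncard = 5 ∧ X ∩ W ⊆ P₂}.ncard +
      {X : Set α | X ⊆ E ∧ X.ncard = 5 ∧ X ∩ W ⊆ P₃}.ncard + {X : Set α | X ⊆ E ∧ X.ncard = 5 ∧ X ∩ W ⊆ P₄}.ncard ≤
      ({X : Set α | X ⊆ E ∧ X.ncard = 5 ∧ X ∩ W ⊆ P₁} ∪ {X : Set α | X ⊆ E ∧ X.ncard = 5 ∧ X ∩ W ⊆ P₂} ∪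
        {X : Set α | X ⊆ E ∧ X.ncard = 5 ∧ X ∩ W ⊆ P₃} ∪ {X : Set α | X ⊆ E ∧ X.ncard = 5 ∧ X ∩ W ⊆ P₄}).ncard +
        3 * {X : Set α | X ⊆ E ∧ X.ncard = 5 ∧ X ∩ W ⊆ ∅}.ncard := by
  classical
  set A₁ := {X : Set α | X ⊆ E ∧ X.ncard = 5 ∧ X ∩ W ⊆ P₁} with hA₁
  set A₂ := {X : Set α | X ⊆ E ∧ X.ncard = 5 ∧ X ∩ W ⊆ P₂} with hA₂
  set A₃ := {X : Set α | X ⊆ E ∧ X.ncard = 5 ∧ X ∩ W ⊆ P₃} with hA₃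
  set A₄ := {X : Set α | X ⊆ E ∧ X.ncard = 5 ∧ X ∩ W ⊆ P₄} with hA₄
  set A₀ := {X : Set α | X ⊆ E ∧ X.ncard = 5 ∧ X ∩ W ⊆ ∅} with hA₀
  have hfin : ∀ (P : Set α), {X : Set α | X ⊆ E ∧ X.ncard = 5 ∧ X ∩ W ⊆ P}.Finite :=
    fun P => hE.finite_subsets.subset (fun X hX => hX.1)
  have hA₀fin : A₀.Finite := hfin ∅
  -- two families with disjoint parts meet inside `A₀`
  have hmeet : ∀ {P Q : Set α}, Disjoint P Q →
      {X : Set α | X ⊆ E ∧ X.ncard = 5 ∧ X ∩ W ⊆ P} ∩ {X : Set α | X ⊆ E ∧ X.ncard = 5 ∧ X ∩ W ⊆ Q} ⊆ A₀ := by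
    rintro P Q hPQ X ⟨⟨hXE, hX5, hXP⟩, ⟨-, -, hXQ⟩⟩
    refine ⟨hXE, hX5, fun x hx => ?_⟩
    exact (Set.disjoint_left.1 hPQ) (hXP hx) (hXQ hx)
  have i12 : (A₁ ∩ A₂).ncard ≤ A₀.ncard := Set.ncard_le_ncard (hmeet h12) hA₀fin
  have i13 : ((A₁ ∪ A₂) ∩ A₃).ncard ≤ A₀.ncard := by
    refine Set.ncard_le_ncard ?_ hA₀fin
    rw [Set.union_inter_distrib_right]
    exact Set.union_subset (hmeet h13) (hmeet h23)
  have i14 : ((A₁ ∪ A₂ ∪ A₃) ∩ A₄).ncard ≤ A₀.ncard := by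
    refine Set.ncard_le_ncard ?_ hA₀fin
    rw [Set.union_inter_distrib_right, Set.union_inter_distrib_right]
    exact Set.union_subset (Set.union_subset (hmeet h14) (hmeet h24)) (hmeet h34)
  have u12 := Set.ncard_union_add_ncard_inter A₁ A₂ (hfin P₁) (hfin P₂)
  have u13 := Set.ncard_union_add_ncard_inter (A₁ ∪ A₂) A₃ ((hfin P₁).union (hfin P₂)) (hfin P₃)
  have u14 := Set.ncard_union_add_ncard_inter (A₁ ∪ A₂ ∪ A₃) A₄ (((hfin P₁).union (hfin P₂)).union (hfin P₃)) (hfin P₄)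
  omega

/-- **A top `5`-set of a corank-`7` core has its trace on `W = T₁ ∪ T₂ ∪ T₃ ∪ T₄` in no private part** `T_i ∖ (the other three)`:
it meets the union of the other three triangles. -/
theorem top_five_trace_not_subset_private (M : Matroid α) [M.Finite] {p : ℕ} (hR : M.eRank = (p : ℕ∞))
    (hn : M.E.ncard = p + 7) (hC1 : ∀ L ⊆ M.E, M.eRk L = 2 → L.ncard ≤ 3)
    {T U : Set α} {T₁ T₂ T₃ : Set α} (hT₁ : M.IsCircuit T₁) (hT₁3 : T₁.ncard = 3) (hT₂ : M.IsCircuit T₂)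
    (hT₂3 : T₂.ncard = 3) (hT₃ : M.IsCircuit T₃) (hT₃3 : T₃.ncard = 3) (h12 : T₁ ≠ T₂) (h13 : T₁ ≠ T₃) (h23 : T₂ ≠ T₃)
    (hU : U = T₁ ∪ T₂ ∪ T₃) {B : Set α} (hBE : B ⊆ M.E) (hB5 : B.ncard = 5) (hBs : M.eRk (M.E \ B) = M.eRank) :
    ¬ (B ∩ (T ∪ U) ⊆ T \ U) := by
  intro hsub
  obtain ⟨x, hxB, hxU⟩ := top_five_inter_union_three_nonempty M hR hn hC1 hT₁ hT₁3 hT₂ hT₂3 hT₃ hT₃3 h12 h13 h23 B hBE hB5 hBs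
  rw [← hU] at hxU
  exact (hsub ⟨hxB, Or.inr hxU⟩).2 hxU

/-- **The supersets of a triangle outside the trace family of its own private part**: at least `C(|E ∖ T|, 2) − C(|E ∖ W|, 2)`
five-supersets of `T` have a trace on `W ⊇ T` not inside `P ⊆ T`. -/
theorem ncard_supersets_outside_trace_ge (M : Matroid α) [M.Finite] {T W P : Set α} (hT : T ⊆ M.E) (hT3 : T.ncard = 3)
    (hP : P ⊆ T) :
    (M.E \ T).ncard.choose 2 ≤
      {X : Set α | X ⊆ M.E ∧ X.ncard = 5 ∧ T ⊆ X ∧ ¬ (X ∩ W ⊆ P)}.ncard + (M.E \ W).ncard.choose 2 := by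
  classical
  have hTfin : T.Finite := M.ground_finite.subset hT
  have hlow : (M.E \ T).ncard.choose 2 ≤ {X : Set α | X ⊆ M.E ∧ X.ncard = 5 ∧ T ⊆ X}.ncard := by
    have h := choose_le_ncard_subsets_superset M hT 5 (by omega)
    rw [hT3] at h
    rw [Set.ncard_sdiff hT hTfin, hT3]
    exact h
  -- the supersets with trace inside `P` inject into the `2`-subsets of `E ∖ W`
  have hin : {X : Set α | X ⊆ M.E ∧ X.ncard = 5 ∧ T ⊆ X ∧ X ∩ W ⊆ P}.ncard ≤ (M.E \ W).ncard.choose 2 := by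
    rw [← ncard_subsets_ncard_eq (M.E \ W) (M.ground_finite.sdiff) 2]
    have hmaps : ∀ X ∈ {X : Set α | X ⊆ M.E ∧ X.ncard = 5 ∧ T ⊆ X ∧ X ∩ W ⊆ P},
        (fun X : Set α => X \ T) X ∈ {Y : Set α | Y ⊆ M.E \ W ∧ Y.ncard = 2} := by
      rintro X ⟨hXE, hX5, hTX, hXP⟩
      refine ⟨fun y ⟨hyX, hyT⟩ => ⟨hXE hyX, fun hyW => hyT (hP (hXP ⟨hyX, hyW⟩))⟩, ?_⟩
      rw [Set.ncard_sdiff hTX hTfin, hX5, hT3]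
    have hinj : Set.InjOn (fun X : Set α => X \ T)
        {X : Set α | X ⊆ M.E ∧ X.ncard = 5 ∧ T ⊆ X ∧ X ∩ W ⊆ P} := by
      rintro X₁ ⟨-, -, hT₁, -⟩ X₂ ⟨-, -, hT₂, -⟩ hEq
      simp only at hEq
      rw [← Set.sdiff_union_of_subset hT₁, ← Set.sdiff_union_of_subset hT₂, hEq]
    exact Set.ncard_le_ncard_of_injOn _ hmaps hinj ((M.ground_finite.sdiff).finite_subsets.subset (fun Y hY => hY.1))
  -- the supersets split into the two families
  have hsplit : {X : Set α | X ⊆ M.E ∧ X.ncard = 5 ∧ T ⊆ X}.ncard ≤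
      {X : Set α | X ⊆ M.E ∧ X.ncard = 5 ∧ T ⊆ X ∧ ¬ (X ∩ W ⊆ P)}.ncard +
        {X : Set α | X ⊆ M.E ∧ X.ncard = 5 ∧ T ⊆ X ∧ X ∩ W ⊆ P}.ncard := by
    refine le_trans (Set.ncard_le_ncard ?_ ((M.ground_finite.finite_subsets.subset (fun X hX => hX.1)).union
      (M.ground_finite.finite_subsets.subset (fun X hX => hX.1)))) (Set.ncard_union_le _ _)
    rintro X ⟨hXE, hX5, hTX⟩
    by_cases h : X ∩ W ⊆ P
    · exact Or.inr ⟨hXE, hX5, hTX, h⟩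
    · exact Or.inl ⟨hXE, hX5, hTX, h⟩
  omega

/-- **Every shared point lies on two triangles**: `2·|S| ≤ Σ_i |T_i ∩ S|` when every point of `S` lies in at least two of the
four sets (`S ⊆` the union of the pairwise intersections). -/
theorem two_mul_ncard_le_sum_of_two_cover {S a₁ a₂ a₃ a₄ : Set α} (hS : S.Finite)
    (h1 : a₁ ⊆ S) (h2 : a₂ ⊆ S) (h3 : a₃ ⊆ S) (h4 : a₄ ⊆ S)
    (hcov : S ⊆ (a₁ ∩ a₂) ∪ (a₃ ∩ a₄) ∪ ((a₁ ∪ a₂) ∩ (a₃ ∪ a₄))) :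
    2 * S.ncard ≤ a₁.ncard + a₂.ncard + a₃.ncard + a₄.ncard := by
  have f1 := hS.subset h1
  have f2 := hS.subset h2
  have f3 := hS.subset h3
  have f4 := hS.subset h4
  have u12 := Set.ncard_union_add_ncard_inter a₁ a₂ f1 f2
  have u34 := Set.ncard_union_add_ncard_inter a₃ a₄ f3 f4
  have u := Set.ncard_union_add_ncard_inter (a₁ ∪ a₂) (a₃ ∪ a₄) (f1.union f2) (f3.union f4)
  have hle1 : ((a₁ ∪ a₂) ∪ (a₃ ∪ a₄)).ncard ≤ S.ncard :=
    Set.ncard_le_ncard (Set.union_subset (Set.union_subset h1 h2) (Set.union_subset h3 h4)) hS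
  have hle3 : S.ncard ≤ ((a₁ ∪ a₂) ∪ (a₃ ∪ a₄)).ncard := by
    refine Set.ncard_le_ncard (hcov.trans ?_) ((f1.union f2).union (f3.union f4))
    rintro x ((hx | hx) | hx)
    · exact Or.inl (Or.inl hx.1)
    · exact Or.inr (Or.inl hx.1)
    · exact Or.inl hx.1
  have hle2 : S.ncard ≤ (a₁ ∩ a₂).ncard + (a₃ ∩ a₄).ncard + ((a₁ ∪ a₂) ∩ (a₃ ∪ a₄)).ncard := by
    refine le_trans (Set.ncard_le_ncard hcov (((f1.inter_of_left _).union (f3.inter_of_left _)).union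
      ((f1.union f2).inter_of_left _))) ?_
    exact le_trans (Set.ncard_union_le _ _) (Nat.add_le_add_right (Set.ncard_union_le _ _) _)
  omega

end S2

end PercRepro
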